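import Summits.AtomisticToContinuum.Crystallization.Theorems.ReggeStarCoercivityDefectFreeCrystallizesPalmDefs
import Summits.AtomisticToContinuum.Crystallization.Theorems.MinimiserShells.Negative.LoadBearing
import Summits.AtomisticToContinuum.Crystallization.Theorems.PalmUnimodularRigidityMinimiserShellsEquilibriumInLawCluster
import Summits.AtomisticToContinuum.Crystallization.Theorems.PalmUnimodularRigidityMinimiserShellsDeepBadPricingOfShellNoBoundary
import Summits.AtomisticToContinuum.Crystallization.Theorems.PalmUnimodularRigidityMinimiserShellsThresholdOfQualShellNoBoundary
import Summits.AtomisticToContinuum.Crystallization.Theorems.ReggeStarCoercivityDefectFreeCrystallizesFunnelFiniteGap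
import Literature.MathematicalPhysics.StatisticalMechanics.MuGSC

/-!
# Covering, boundary count and the funnel finite gap give the funnel threshold pricing (stub F11 of line `palm-good-law`,
# crux stmt-AtomisticToContinuum-13603)

Stub `stub_funnelPricing_of_funnelFiniteGap` of the lead-c2 skeleton `Cruxes/DefectFreeCrystallizes/Lines/palm_good_law.lean`:
its conclusion is VERBATIM the hypothesis of the landed `Theorems.PalmGoodLaw.funnelToShells_of_funnelThresholdPricing`
(`Theorems/ReggeStarCoercivityDefectFreeCrystallizesFunnelReduction.lean`).  Template: 9225's S11
`Theorems/PalmUnimodularRigidityMinimiserShellsThresholdOfQualShellNoBoundary.lean`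
(`QualShellNoBoundary.stub_thresholdBadPricing_of_qualShellNoBoundary`).

If (hcov) every point of `ℝ³` is within distance `< 1` of every non-empty everywhere-`SetGood` set, (hbdry) the
`6/5`-boundary layer of a cube window `S ∩ [a, a+L)³` of a `δ`-separated set has `≤ c(δ) · L²` points, and (hgap) the
FUNNEL FINITE gap holds — for every `t > 0` some `κ, s > 0` with `N · (e* + κ) ≤ 𝓔_N(y)` for every finite injective
`y : Fin N → ℝ³` with at most `s · N` indices not `SetGood` in `range y` and at least `t · N` badly-shelled indices —
then the funnel threshold pricing holds with `R₀ = 2`, the same `κ` and `L₀ = max 4 (64 c / s)`: in every cube window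
`C = S ∩ [a, a+L)³`, `L ≥ L₀`, of an everywhere-`SetGood` `δ`-separated `S` whose `2`-deep sites badly shelled in `S`
number at least `t · #C`, one has `#C · (e* + κ) ≤ ½ ∑∑_C V_LJ` (the `μ`GSC hypothesis is not used).

Proof.  Enumerate `C` canonically (`Finset.equivFin`); its interaction energy is `½ ∑∑_C V_LJ`
(`two_mul_interactionEnergy_equivFin`) and it has `≥ #G ≥ t · #C` badly-shelled indices (`card_le_natCard_bad`,
locality of `GoodShell`).  Budget: an index whose site has all coordinates in `[a_j + 6/5, a_j + L − 6/5)` sees,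
within distance `6/5`, only points of `S` inside the window (a coordinate difference is at most the distance), so by
the locality of `SetGood` (it reads only the OPEN ball of radius `6/5`; `FunnelFiniteGap.setGood_congr_of_closedBall`)
it is `SetGood` in `C` because it is `SetGood` in `S`; hence the non-`SetGood` indices inject into the boundary
layer, of size `≤ c · L²` (hbdry).  Density: `S ≠ ∅` (else `#C = 0` and the claim is `0 ≤ 0`), so every centre
`a + 2k + 1`, `k ∈ {0, …, n−1}³`, `n = ⌊L/2⌋`, has a point of `S` within `< 1`, i.e. in the open box
`a + 2k + (0, 2)³ ⊆ [a, a+L)³`; these boxes are pairwise disjoint, so `#C ≥ n³ ≥ (L/4)³` for `L ≥ 4`, and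
`c · L² ≤ s · (L/4)³ ≤ s · #C` once `L ≥ 64 c / s`.  Now hgap applies to the enumeration.
-/

noncomputable section

open MeasureTheory
open scoped ENNReal BigOperators Classical

namespace Summit.AtomisticToContinuum.Crystallization.Theorems.PalmGoodLaw.FunnelPricing

open Literature.MathematicalPhysics.StatisticalMechanics (lennardJones IsMuGSC interactionEnergy)
open Summit.AtomisticToContinuum.Crystallization.Theorems.MinimiserShells.Negative.LoadBearing (eStar GoodShell)
open Summit.AtomisticToContinuum.Crystallization.Theorems.MinimiserShells.Negative.Rootedness (E3)
open Summit.AtomisticToContinuum.Crystallization.Theorems.PalmUnimodularRigidityMinimiserShells.EquilibriumInLaw.Cluster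
  (two_mul_interactionEnergy_equivFin)
open Summit.AtomisticToContinuum.Crystallization.Theorems.PalmUnimodularRigidityMinimiserShells.ShellNoBoundary
  (equivFin_symm_val_injective range_equivFin_symm_val card_le_natCard_bad)
open Summit.AtomisticToContinuum.Crystallization.Theorems.PalmGoodLaw.FunnelFiniteGap (setGood_congr_of_closedBall)

/-! ## Coordinates and deep interior sites -/

/-- A coordinate difference of two points of `ℝ³` is at most their Euclidean distance. [folklore] -/
theorem abs_sub_apply_le_dist (x y : E3) (i : Fin 3) : |x i - y i| ≤ dist x y := by
  rw [← Real.dist_eq]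
  exact PiLp.dist_apply_le x y i

/-- **Interior sites are `6/5`-deep in the window.**  If `C = S ∩ [a, a + L)³` and every coordinate of `y` lies in
`[a_j + 6/5, a_j + L − 6/5)`, then every point of `S` within distance `6/5` of `y` lies in `C`. [folklore] -/
theorem inter_closedBall_subset_of_interior {S : Set E3} {C : Finset E3} {a : Fin 3 → ℝ} {L : ℝ}
    (hC : (↑C : Set E3) = S ∩ {z : E3 | ∀ i, a i ≤ z i ∧ z i < a i + L}) {y : E3}
    (hy : ∀ j, a j + 6 / 5 ≤ y j ∧ y j < a j + L - 6 / 5) :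
    S ∩ Metric.closedBall y (6 / 5) ⊆ ↑C := by
  rintro z ⟨hzS, hz⟩
  rw [hC]
  refine ⟨hzS, fun j => ?_⟩
  have h1 : |z j - y j| ≤ 6 / 5 := (abs_sub_apply_le_dist z y j).trans (Metric.mem_closedBall.1 hz)
  rw [abs_le] at h1
  obtain ⟨hl, hu⟩ := hy j
  constructor <;> linarith [h1.1, h1.2]

/-! ## The non-`SetGood` budget of a window -/

/-- **Non-`SetGood` indices of the enumeration of a window lie in the boundary layer.**  For the canonical
enumeration of a cube window `C = S ∩ [a, a + L)³` of an everywhere-`SetGood` set `S`, every index not `SetGood` in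
`range = C` has its site in the `6/5`-boundary layer of the window: an interior site sees within `6/5` only window
points (`inter_closedBall_subset_of_interior`), so it is `SetGood` in `C` by the locality of `SetGood`
(`FunnelFiniteGap.setGood_congr_of_closedBall`). [folklore] -/
theorem natCard_notSetGood_le_card_filter {S : Set E3} (hgood : ∀ y ∈ S, SetGood S y) {C : Finset E3}
    {a : Fin 3 → ℝ} {L : ℝ} (hC : (↑C : Set E3) = S ∩ {z : E3 | ∀ i, a i ≤ z i ∧ z i < a i + L}) :
    Nat.card {i : Fin C.card // ¬ SetGood (Set.range (fun i => ((C.equivFin.symm i : C) : E3)))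
        ((C.equivFin.symm i : C) : E3)} ≤
      (C.filter (fun z : E3 => ∃ i : Fin 3, z i < a i + 6 / 5 ∨ a i + L - 6 / 5 ≤ z i)).card := by
  have hCS : (↑C : Set E3) ⊆ S := hC ▸ Set.inter_subset_left
  have hrange := range_equivFin_symm_val C
  have hSS : Set.range (fun i => ((C.equivFin.symm i : C) : E3)) ⊆ S := by
    rw [hrange]
    exact hCS
  have hmem : ∀ i : {i : Fin C.card // ¬ SetGood (Set.range (fun i => ((C.equivFin.symm i : C) : E3)))
      ((C.equivFin.symm i : C) : E3)},
      ((C.equivFin.symm i.1 : C) : E3) ∈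
        C.filter (fun z : E3 => ∃ i : Fin 3, z i < a i + 6 / 5 ∨ a i + L - 6 / 5 ≤ z i) := by
    rintro ⟨i, hi⟩
    refine Finset.mem_filter.2 ⟨(C.equivFin.symm i).2, ?_⟩
    by_contra h
    push Not at h
    apply hi
    have hloc := inter_closedBall_subset_of_interior hC (y := ((C.equivFin.symm i : C) : E3)) h
    rw [← hrange] at hloc
    exact (setGood_congr_of_closedBall hSS le_rfl hloc).1 (hgood _ (hCS (C.equivFin.symm i).2))
  refine le_trans (Nat.card_le_card_of_injective
    (fun i => (⟨_, hmem i⟩ :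
      {z // z ∈ C.filter (fun z : E3 => ∃ i : Fin 3, z i < a i + 6 / 5 ∨ a i + L - 6 / 5 ≤ z i)}))
    (fun i j hij => by
      have h := congrArg
        (fun z : {z // z ∈ C.filter (fun z : E3 => ∃ i : Fin 3, z i < a i + 6 / 5 ∨ a i + L - 6 / 5 ≤ z i)} =>
          (z : E3)) hij
      exact Subtype.ext (equivFin_symm_val_injective C h)))
    (Nat.card_eq_finsetCard _).le

/-! ## Density of covered windows -/

/-- **Covered windows are dense.**  If every point of `ℝ³` is within distance `< 1` of `S` and `2 n ≤ L`, the window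
`S ∩ [a, a + L)³` has at least `n³` points: the points of `S` near the `n³` centres `a + 2k + 1`, `k ∈ {0, …, n−1}³`,
lie in the pairwise disjoint open boxes `a + 2k + (0, 2)³ ⊆ [a, a + L)³`. [folklore] -/
theorem pow_three_le_card_of_covering {S : Set E3} (hcov : ∀ p : E3, ∃ y ∈ S, dist y p < 1) {C : Finset E3}
    {a : Fin 3 → ℝ} {L : ℝ} (hC : (↑C : Set E3) = S ∩ {z : E3 | ∀ i, a i ≤ z i ∧ z i < a i + L}) {n : ℕ}
    (hn : 2 * (n : ℝ) ≤ L) : n ^ 3 ≤ C.card := by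
  choose f hfS hfd using fun k : Fin 3 → Fin n =>
    hcov (WithLp.toLp 2 (fun j => a j + 2 * ((k j : ℕ) : ℝ) + 1))
  have hbox : ∀ (k : Fin 3 → Fin n) (j : Fin 3),
      a j + 2 * ((k j : ℕ) : ℝ) < f k j ∧ f k j < a j + 2 * ((k j : ℕ) : ℝ) + 2 := by
    intro k j
    have h := (abs_sub_apply_le_dist (f k) (WithLp.toLp 2 (fun j => a j + 2 * ((k j : ℕ) : ℝ) + 1)) j).trans_lt
      (hfd k)
    rw [PiLp.toLp_apply, abs_lt] at h
    constructor <;> linarith [h.1, h.2]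
  have hmemC : ∀ k, f k ∈ C := by
    intro k
    rw [← Finset.mem_coe, hC]
    refine ⟨hfS k, fun j => ?_⟩
    have hk : ((k j : ℕ) : ℝ) + 1 ≤ n := by exact_mod_cast (k j).2
    have hk0 : (0 : ℝ) ≤ ((k j : ℕ) : ℝ) := Nat.cast_nonneg _
    obtain ⟨h1, h2⟩ := hbox k j
    constructor <;> linarith
  have hinj : Function.Injective f := by
    intro k k' hkk'
    funext j
    apply Fin.ext
    obtain ⟨h1, h2⟩ := hbox k j
    obtain ⟨h1', h2'⟩ := hbox k' j
    rw [hkk'] at h1 h2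
    have e1 : ((k j : ℕ) : ℝ) < (k' j : ℕ) + 1 := by linarith
    have e2 : ((k' j : ℕ) : ℝ) < (k j : ℕ) + 1 := by linarith
    have e1' : (k j : ℕ) < k' j + 1 := by exact_mod_cast e1
    have e2' : (k' j : ℕ) < k j + 1 := by exact_mod_cast e2
    omega
  calc n ^ 3 = (Finset.univ.image f).card := by
        rw [Finset.card_image_of_injective _ hinj, Finset.card_univ, Fintype.card_fun, Fintype.card_fin,
          Fintype.card_fin]
    _ ≤ C.card := Finset.card_le_card (fun z hz => by
        obtain ⟨k, -, rfl⟩ := Finset.mem_image.1 hz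
        exact hmemC k)

/-! ## Window-size arithmetic -/

/-- **Window-size arithmetic.**  For `L ≥ max 4 (64 c / s)` one has `c · L² ≤ s · ⌊L/2⌋³`
(`⌊L/2⌋ > L/2 − 1 ≥ L/4` and `64 c ≤ s L`). [folklore] -/
theorem mul_sq_le_mul_floor_pow_three {c s L : ℝ} (hs : 0 < s) (hL : max 4 (64 * c / s) ≤ L) :
    c * L ^ 2 ≤ s * ((⌊L / 2⌋₊ : ℕ) : ℝ) ^ 3 := by
  have h4 : 4 ≤ L := le_trans (le_max_left _ _) hL
  have h64 : 64 * c / s ≤ L := le_trans (le_max_right _ _) hL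
  have h64' : 64 * c ≤ L * s := (div_le_iff₀ hs).1 h64
  have hfl : L / 2 < ((⌊L / 2⌋₊ : ℕ) : ℝ) + 1 := Nat.lt_floor_add_one _
  have hq : L / 4 ≤ ((⌊L / 2⌋₊ : ℕ) : ℝ) := by linarith
  have hq3 : (L / 4) ^ 3 ≤ ((⌊L / 2⌋₊ : ℕ) : ℝ) ^ 3 := pow_le_pow_left₀ (by linarith) hq 3
  have hL2 : 0 ≤ L ^ 2 := sq_nonneg L
  have hm : 64 * c * L ^ 2 ≤ L * s * L ^ 2 := mul_le_mul_of_nonneg_right h64' hL2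
  calc c * L ^ 2 ≤ s * (L / 4) ^ 3 := by
        have e : s * (L / 4) ^ 3 = L * s * L ^ 2 / 64 := by ring
        rw [e]
        linarith
    _ ≤ s * ((⌊L / 2⌋₊ : ℕ) : ℝ) ^ 3 := mul_le_mul_of_nonneg_left hq3 hs.le

/-! ## The stub -/

/-- **Stub `stub_funnelPricing_of_funnelFiniteGap` (F11) of line `palm-good-law`.**  Covering radius `< 1` of
every-point-`SetGood` sets, the `O(L²)` boundary-layer count and the funnel finite gap imply the funnel threshold
pricing on cube windows of everywhere-`SetGood` `δ`-separated sets, with `R₀ = 2`, the gap's `κ` and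
`L₀ = max 4 (64 c / s)` (the `μ`GSC hypothesis is not used). [folklore] -/
theorem stub_funnelPricing_of_funnelFiniteGap :
    (∀ S : Set (EuclideanSpace ℝ (Fin 3)), (∀ y ∈ S, SetGood S y) →
      ∀ x ∈ S, ∀ p : EuclideanSpace ℝ (Fin 3), ∃ y ∈ S, dist y p < 1) →
    (∀ δ : ℝ, 0 < δ → ∃ c : ℝ, 0 < c ∧
      ∀ S : Set (EuclideanSpace ℝ (Fin 3)), (∀ x ∈ S, ∀ z ∈ S, x ≠ z → δ ≤ dist x z) →
        ∀ L : ℝ, 1 ≤ L → ∀ a : Fin 3 → ℝ, ∀ B : Finset (EuclideanSpace ℝ (Fin 3)),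
          (↑B : Set (EuclideanSpace ℝ (Fin 3))) ⊆
            S ∩ {z : EuclideanSpace ℝ (Fin 3) | ∀ i, a i ≤ z i ∧ z i < a i + L} →
          (∀ z ∈ B, ∃ i : Fin 3, z i < a i + 6 / 5 ∨ a i + L - 6 / 5 ≤ z i) →
          (B.card : ℝ) ≤ c * L ^ 2) →
    (∀ t : ℝ, 0 < t → ∃ κ : ℝ, 0 < κ ∧ ∃ s : ℝ, 0 < s ∧
      ∀ (N : ℕ) (y : Fin N → EuclideanSpace ℝ (Fin 3)), Function.Injective y →
        (Nat.card {i : Fin N // ¬ SetGood (Set.range y) (y i)} : ℝ) ≤ s * (N : ℝ) →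
        t * (N : ℝ) ≤ (Nat.card {i : Fin N // ¬ GoodShell
            ((Measure.count : Measure (EuclideanSpace ℝ (Fin 3))).restrict ((fun z => z - y i) '' Set.range y))} : ℝ) →
        (N : ℝ) * (eStar + κ) ≤ interactionEnergy lennardJones y) →
    ∀ δ : ℝ, 0 < δ → ∀ t : ℝ, 0 < t → ∃ L₀ R₀ κ : ℝ, 0 < L₀ ∧ 0 < R₀ ∧ 0 < κ ∧
      ∀ S : Set (EuclideanSpace ℝ (Fin 3)), (∀ x ∈ S, ∀ z ∈ S, x ≠ z → δ ≤ dist x z) →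
        IsMuGSC lennardJones eStar S → (∀ y ∈ S, SetGood S y) →
        ∀ L : ℝ, L₀ ≤ L → ∀ a : Fin 3 → ℝ, ∀ C : Finset (EuclideanSpace ℝ (Fin 3)),
          (↑C : Set (EuclideanSpace ℝ (Fin 3))) =
            S ∩ {z : EuclideanSpace ℝ (Fin 3) | ∀ i, a i ≤ z i ∧ z i < a i + L} →
        ∀ G : Finset (EuclideanSpace ℝ (Fin 3)), G ⊆ C →
          (∀ y ∈ G, ¬ GoodShell ((Measure.count : Measure (EuclideanSpace ℝ (Fin 3))).restrict
              ((fun z => z - y) '' S)) ∧ S ∩ Metric.closedBall y R₀ ⊆ ↑C) →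
          t * (C.card : ℝ) ≤ (G.card : ℝ) →
          (C.card : ℝ) * (eStar + κ) ≤ (∑ x ∈ C, ∑ z ∈ C, lennardJones (dist x z)) / 2 := by
  intro hcov hbdry hgap δ hδ t ht
  obtain ⟨κ, hκ, s, hs, hgapt⟩ := hgap t ht
  obtain ⟨c, _, hbdryc⟩ := hbdry δ hδ
  refine ⟨max 4 (64 * c / s), 2, κ, lt_of_lt_of_le four_pos (le_max_left _ _), two_pos, hκ,
    fun S hsep _ hgood L hL a C hC G hGC hG hthr => ?_⟩
  rcases C.eq_empty_or_nonempty with rfl | ⟨x₀, hx₀⟩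
  · simp
  have hCS : (↑C : Set E3) ⊆ S := hC ▸ Set.inter_subset_left
  have hcovS : ∀ p : E3, ∃ y ∈ S, dist y p < 1 := hcov S hgood x₀ (hCS hx₀)
  have h4 : (4 : ℝ) ≤ L := le_trans (le_max_left _ _) hL
  have h2 := two_mul_interactionEnergy_equivFin C
  have hle : (G.card : ℝ) ≤ (Nat.card {i : Fin C.card // ¬ GoodShell
      ((Measure.count : Measure E3).restrict ((fun z => z - ((C.equivFin.symm i : C) : E3)) ''
        Set.range (fun i => ((C.equivFin.symm i : C) : E3))))} : ℝ) := by
    exact_mod_cast card_le_natCard_bad hCS (by norm_num : (5 : ℝ) / 4 ≤ 2) hGC hG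
      (range_equivFin_symm_val C)
  have hdens : ((⌊L / 2⌋₊ : ℕ) : ℝ) ^ 3 ≤ (C.card : ℝ) := by
    exact_mod_cast pow_three_le_card_of_covering hcovS hC (n := ⌊L / 2⌋₊)
      (by linarith [Nat.floor_le (by linarith : (0 : ℝ) ≤ L / 2)])
  have hbud : (Nat.card {i : Fin C.card // ¬ SetGood (Set.range (fun i => ((C.equivFin.symm i : C) : E3)))
      ((C.equivFin.symm i : C) : E3)} : ℝ) ≤ s * (C.card : ℝ) :=
    calc (Nat.card {i : Fin C.card // ¬ SetGood (Set.range (fun i => ((C.equivFin.symm i : C) : E3)))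
          ((C.equivFin.symm i : C) : E3)} : ℝ)
          ≤ ((C.filter (fun z : E3 => ∃ i : Fin 3, z i < a i + 6 / 5 ∨ a i + L - 6 / 5 ≤ z i)).card : ℝ) := by
          exact_mod_cast natCard_notSetGood_le_card_filter hgood hC
      _ ≤ c * L ^ 2 := hbdryc S hsep L (by linarith) a _
          ((Finset.coe_subset.2 (Finset.filter_subset _ C)).trans hC.subset)
          (fun z hz => (Finset.mem_filter.1 hz).2)
      _ ≤ s * ((⌊L / 2⌋₊ : ℕ) : ℝ) ^ 3 := mul_sq_le_mul_floor_pow_three hs hL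
      _ ≤ s * (C.card : ℝ) := mul_le_mul_of_nonneg_left hdens hs.le
  have hE := hgapt C.card (fun i => ((C.equivFin.symm i : C) : E3)) (equivFin_symm_val_injective C) hbud
    (hthr.trans hle)
  linarith

end Summit.AtomisticToContinuum.Crystallization.Theorems.PalmGoodLaw.FunnelPricing

end
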